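import Summits.KontsevichZagierPeriods.KontsevichZagierPeriods.Theorems.HurwitzMicroSectorsNormalFormPrincipleM2CycloReduce
import Summits.KontsevichZagierPeriods.KontsevichZagierPeriods.Theorems.HurwitzMicroSectorsNormalFormPrincipleM2AffineUnfoldBoxSubLogMonomial
import Summits.KontsevichZagierPeriods.KontsevichZagierPeriods.Theorems.HurwitzMicroSectorsNormalFormPrincipleM2AffineUnfoldKit

/-!
# `NormalFormPrinciple` (stmt-KontsevichZagierPeriods-3869), line `SketchIdeator1` — leaf `stub_boxRigidity`:
# AFFINE-UNFOLDABLE BOXES `[(0,1)², k/(A(x) + xy)]` lie in the cyclotomic log layer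

Composition (lead seat c8) of the two wave-5 stubs (`affineUnfold_box_sub_logMonomial`,
`affineUnfold_kit`, landed) with the cyclotomic log layer (`…M2CycloReduce`). ONE
affine substitution `s = 1 + xy/A(x)` along the last coordinate (rule 2) turns the box
`[band-box, 1/(A(x)+xy)]` (`A` `ℚ`-semialgebraic, differentiable, positive on `(0,1)`) into the unfolded
log monomial `M(1/x, (A(x)+x)/A(x))`; whenever `(A+x)/A` is a cyclotomic quotient `F/F'` the box is
therefore congruent to ONE level-one box `[(0,1)², k(ρ(F) − ρ(F'))/(1−xy)]` (`affineBox_reduce`), hence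
Conjecture 1 holds for it against every level-one box (`affineBox_equivalent_levelOne_of_value_eq`).
Instances (transcendence-free, rules (1a), (1b), (2) only): `A = 1 + x²` (P3, `5ζ(2)/12`), `A = 1`
(`ζ(2)/2`), and the NEW ones `[(0,1)², 3/(1+x+x²+xy)] ~ [(0,1)², 1/(1−xy)]` (`A = 1+x+x²`,
`(A+x)/A = (1+x)²/(1+x+x²)`) and `[(0,1)², 12/(1−x+x²+xy)] ~ [(0,1)², 7/(1−xy)]` (`A = Φ₆ = 1−x+x²`,
`(A+x)/A = (1+x²)/(1−x+x²) = H₁H₆/(H₃H₄)` with `H_d = 1/(1−xᵈ)`).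
References: M. Kontsevich, D. Zagier, *Periods* (2001), §1.2 (rules (1), (2), Conjecture 1).
No definitions are introduced.
-/

noncomputable section

open MeasureTheory Set
open Literature.NumberTheory.Transcendental Literature.NumberTheory.Transcendental.KZ
open Literature.ModelTheory.ExponentialFields (IsSemialgebraic)

namespace Summit.KontsevichZagierPeriods.HurwitzMicroSectors.NormalFormPrinciple.PiBox.M2

open Summit.KontsevichZagierPeriods.HurwitzMicroSectors.NormalFormPrinciple.PiBox.LevelOne
  (exists_zetaTwoRep zetaTwoRep_congr_mem_relations mem_relations_of_eval_eq_zero_of_mem_closure)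
/-! ## The composition (lead): affine-unfoldable boxes lie in the cyclotomic log layer -/


/-- **Reduction of an affine-unfoldable box to a level-one box.** If `A` is `ℚ`-semialgebraic,
differentiable and positive on `(0,1)`, the band-box `[band-box, 1/(A(x)+xy)]` exists, and
`(A(x)+x)/A(x) = F(x)/F'(x)` on `(0,1)` for cyclotomic products `F' ≤ F`, then every representation on the
open box with integrand `1/(A(x)+xy)` on it is congruent to the level-one box
`[(0,1)², (ρ(F) − ρ(F'))/(1 − xy)]` (rules 1a, 1b, 2). [cite: KontsevichZagier2001, §1.2] -/
theorem affineBox_reduce (A : ℝ → ℝ)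
    (hA : IsSemialgebraicFunOn ℚ {y : Fin 1 → ℝ | 0 < y 0 ∧ y 0 < 1} (fun y => A (y 0)))
    (hAd : DifferentiableOn ℝ (fun y : Fin 1 → ℝ => A (y 0)) {y : Fin 1 → ℝ | 0 < y 0 ∧ y 0 < 1})
    (hA0 : ∀ x ∈ Set.Ioo (0:ℝ) 1, 0 < A x)
    (hT : ∃ T : IntegralRep 2,
      T.domain = KZlog.band {y : Fin 1 → ℝ | 0 < y 0 ∧ y 0 < 1} (fun _ => (0:ℝ)) (fun _ => (1:ℝ)) ∧
      T.integrand = fun z => 1 / (A (z 0) + z 0 * z 1))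
    (n : ℕ) (a b a' b' : ℕ → ℕ)
    (hfac : ∀ t ∈ Set.Ioo (0:ℝ) 1, (A t + t) / A t =
      (∏ d ∈ Finset.range n, (∑ i ∈ Finset.range (d + 1), t ^ i) ^ (a d) * (1 / (1 - t ^ (d + 1))) ^ (b d)) /
      (∏ d ∈ Finset.range n, (∑ i ∈ Finset.range (d + 1), t ^ i) ^ (a' d) * (1 / (1 - t ^ (d + 1))) ^ (b' d)))
    (k : ℕ) (N B : IntegralRep 2) (hNd : N.domain = {x | ∀ i, x i ∈ Set.Ioo (0:ℝ) 1})
    (hNi : EqOn N.integrand (fun z => (k : ℝ) / (A (z 0) + z 0 * z 1)) N.domain)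
    (hBd : B.domain = {x | ∀ i, x i ∈ Set.Ioo (0:ℝ) 1})
    (hBi : EqOn B.integrand (fun x => (((k : ℚ) * ((∑ d ∈ Finset.range n,
      ((a d : ℚ) * (1 - 1 / (d + 1)) + (b d : ℚ) / (d + 1)) - ∑ d ∈ Finset.range n,
      ((a' d : ℚ) * (1 - 1 / (d + 1)) + (b' d : ℚ) / (d + 1)))) : ℚ) : ℝ) / (1 - x 0 * x 1)) B.domain) :
    of N - of B ∈ relations := by
  have hG := isSemialgebraic_unitInterval_fin_one
  obtain ⟨T, hTd, hTi⟩ := hT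
  obtain ⟨hnsmul, hboxband, -, -⟩ := bookkeeping_kit
  -- the cyclotomic monomial `R = M(1/x, F/F')`
  obtain ⟨hsa, h1, hint⟩ := cyclo_kit n a b
  obtain ⟨hsa', h1', hint'⟩ := cyclo_kit n a' b'
  have hpos' : ∀ t ∈ Set.Ioo (0:ℝ) 1, (0:ℝ) <
      ∏ d ∈ Finset.range n, (∑ i ∈ Finset.range (d + 1), t ^ i) ^ (a' d) * (1 / (1 - t ^ (d + 1))) ^ (b' d) :=
    fun t ht => zero_lt_one.trans_le (h1' t ht)
  have hpos : ∀ t ∈ Set.Ioo (0:ℝ) 1, (0:ℝ) <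
      ∏ d ∈ Finset.range n, (∑ i ∈ Finset.range (d + 1), t ^ i) ^ (a d) * (1 / (1 - t ^ (d + 1))) ^ (b d) :=
    fun t ht => zero_lt_one.trans_le (h1 t ht)
  have hle : ∀ t ∈ Set.Ioo (0:ℝ) 1,
      ∏ d ∈ Finset.range n, (∑ i ∈ Finset.range (d + 1), t ^ i) ^ (a' d) * (1 / (1 - t ^ (d + 1))) ^ (b' d) ≤
      ∏ d ∈ Finset.range n, (∑ i ∈ Finset.range (d + 1), t ^ i) ^ (a d) * (1 / (1 - t ^ (d + 1))) ^ (b d) := by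
    intro t ht
    have h1 : 1 ≤ (A t + t) / A t := by
      rw [le_div_iff₀ (hA0 t ht)]
      linarith [ht.1]
    rw [hfac t ht] at h1
    exact (one_le_div (hpos' t ht)).1 h1
  have hw : IsSemialgebraicFunOn ℚ {y : Fin 1 → ℝ | 0 < y 0 ∧ y 0 < 1}
      (fun y => (fun t : ℝ => (∏ d ∈ Finset.range n,
        (∑ i ∈ Finset.range (d + 1), t ^ i) ^ (a d) * (1 / (1 - t ^ (d + 1))) ^ (b d)) /
        (∏ d ∈ Finset.range n,
        (∑ i ∈ Finset.range (d + 1), t ^ i) ^ (a' d) * (1 / (1 - t ^ (d + 1))) ^ (b' d))) (y 0)) :=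
    IsSemialgebraicFunOn.div hsa hsa' fun y hy => (hpos' (y 0) ⟨hy.1, hy.2⟩).ne'
  have hw1 : ∀ t ∈ Set.Ioo (0:ℝ) 1, 1 ≤ (fun t : ℝ => (∏ d ∈ Finset.range n,
        (∑ i ∈ Finset.range (d + 1), t ^ i) ^ (a d) * (1 / (1 - t ^ (d + 1))) ^ (b d)) /
        (∏ d ∈ Finset.range n,
        (∑ i ∈ Finset.range (d + 1), t ^ i) ^ (a' d) * (1 / (1 - t ^ (d + 1))) ^ (b' d))) t :=
    fun t ht => (one_le_div (hpos' t ht)).2 (hle t ht)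
  have hwint : IntegrableOn (fun t : ℝ => (fun x : ℝ => 1 / x) t * Real.log ((fun t : ℝ => (∏ d ∈ Finset.range n,
        (∑ i ∈ Finset.range (d + 1), t ^ i) ^ (a d) * (1 / (1 - t ^ (d + 1))) ^ (b d)) /
        (∏ d ∈ Finset.range n,
        (∑ i ∈ Finset.range (d + 1), t ^ i) ^ (a' d) * (1 / (1 - t ^ (d + 1))) ^ (b' d))) t))
      (Set.Ioo (0:ℝ) 1) := by
    refine ((hint 1).sub (hint' 1)).congr_fun (fun t ht => ?_) measurableSet_Ioo
    simp only [Pi.sub_apply]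
    rw [Real.log_div (hpos t ht).ne' (hpos' t ht).ne']
    ring
  obtain ⟨R, hRd, hRi⟩ := exists_logMonomialRep _ _ isSemialgebraicFunOn_one_div hw hw1 hwint
  -- open box versus band-box
  have e0 : of N - k • of T ∈ relations := by
    refine hboxband k (fun z => 1 / (A (z 0) + z 0 * z 1)) N T hNd (fun x hx => ?_) hTd (hTi ▸ fun _ _ => rfl)
    rw [hNi hx]
    beta_reduce
    ring
  -- the affine unfolding onto `R` (whose edge is `(A+x)/A` on `(0,1)`)
  have e1 : of T - of R ∈ relations :=
    affineUnfold_box_sub_logMonomial A hA hAd hA0 T R hTd (hTi ▸ fun _ _ => rfl)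
      (hRd.trans (KZlog.band_congr fun y hy => (hfac (y 0) ⟨hy.1, hy.2⟩).symm)) (hRi ▸ fun _ _ => rfl)
  -- the cyclotomic reduction of `R` onto the level-one box with coefficient `ρ − ρ'`
  obtain ⟨B₁, hB₁d, hB₁i⟩ := exists_zetaTwoRep ((1 : ℚ) * (∑ d ∈ Finset.range n,
      ((a d : ℚ) * (1 - 1 / (d + 1)) + (b d : ℚ) / (d + 1)) - ∑ d ∈ Finset.range n,
      ((a' d : ℚ) * (1 - 1 / (d + 1)) + (b' d : ℚ) / (d + 1))))
  have e2 : of R - of B₁ ∈ relations := by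
    refine cycloMonomial_reduce 1 n a b a' b' hle R B₁ hRd (fun z _ => ?_) hB₁d hB₁i
    rw [hRi]
    push_cast
    ring
  -- `k` copies of the level-one box
  have e3 : of B - k • of B₁ ∈ relations := by
    refine hnsmul k B B₁ (hB₁d.trans hBd.symm) fun x hx => ?_
    beta_reduce
    rw [hBi hx, hB₁i (by rw [hB₁d, ← hBd]; exact hx)]
    push_cast
    ring
  have e : of N - of B = (of N - k • of T) + k • (of T - of R) + k • (of R - of B₁) - (of B - k • of B₁) := by
    rw [nsmul_sub, nsmul_sub]
    abel
  rw [e]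
  exact relations.sub_mem (relations.add_mem (relations.add_mem e0 (relations.nsmul_mem e1 k))
    (relations.nsmul_mem e2 k)) e3

/-- **Conjecture 1 for an affine-unfoldable box against any level-one box** of equal value
(`A`, `F`, `F'` as in `affineBox_reduce`). [cite: KontsevichZagier2001, §1.2 Conjecture 1] -/
theorem affineBox_equivalent_levelOne_of_value_eq (A : ℝ → ℝ)
    (hA : IsSemialgebraicFunOn ℚ {y : Fin 1 → ℝ | 0 < y 0 ∧ y 0 < 1} (fun y => A (y 0)))
    (hAd : DifferentiableOn ℝ (fun y : Fin 1 → ℝ => A (y 0)) {y : Fin 1 → ℝ | 0 < y 0 ∧ y 0 < 1})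
    (hA0 : ∀ x ∈ Set.Ioo (0:ℝ) 1, 0 < A x)
    (hT : ∃ T : IntegralRep 2,
      T.domain = KZlog.band {y : Fin 1 → ℝ | 0 < y 0 ∧ y 0 < 1} (fun _ => (0:ℝ)) (fun _ => (1:ℝ)) ∧
      T.integrand = fun z => 1 / (A (z 0) + z 0 * z 1))
    (n : ℕ) (a b a' b' : ℕ → ℕ)
    (hfac : ∀ t ∈ Set.Ioo (0:ℝ) 1, (A t + t) / A t =
      (∏ d ∈ Finset.range n, (∑ i ∈ Finset.range (d + 1), t ^ i) ^ (a d) * (1 / (1 - t ^ (d + 1))) ^ (b d)) /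
      (∏ d ∈ Finset.range n, (∑ i ∈ Finset.range (d + 1), t ^ i) ^ (a' d) * (1 / (1 - t ^ (d + 1))) ^ (b' d)))
    (k : ℕ) (N N' : IntegralRep 2) (P : MvPolynomial (Fin 2) ℚ)
    (hNd : N.domain = {x | ∀ i, x i ∈ Set.Ioo (0:ℝ) 1})
    (hNi : EqOn N.integrand (fun z => (k : ℝ) / (A (z 0) + z 0 * z 1)) N.domain)
    (hN'd : N'.domain = {x | ∀ i, x i ∈ Set.Ioo (0:ℝ) 1})
    (hN'i : EqOn N'.integrand (fun x => (MvPolynomial.aeval x P : ℝ) / (1 - x 0 * x 1)) N'.domain)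
    (hv : N.value = N'.value) : Equivalent N N' := by
  obtain ⟨B, hBd, hBi⟩ := exists_zetaTwoRep ((k : ℚ) * ((∑ d ∈ Finset.range n,
      ((a d : ℚ) * (1 - 1 / (d + 1)) + (b d : ℚ) / (d + 1)) - ∑ d ∈ Finset.range n,
      ((a' d : ℚ) * (1 - 1 / (d + 1)) + (b' d : ℚ) / (d + 1)))))
  have e1 := affineBox_reduce A hA hAd hA0 hT n a b a' b' hfac k N B hNd hNi hBd hBi
  have hvB : N.value = B.value := Equivalent.value_eq_holds e1
  have e2 : of B - of N' ∈ relations := by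
    refine mem_relations_of_eval_eq_zero_of_mem_closure (AddSubgroup.sub_mem _
      (AddSubgroup.subset_closure (Or.inl ⟨MvPolynomial.C ((k : ℚ) * ((∑ d ∈ Finset.range n, ((a d : ℚ) * (1 - 1 / (d + 1)) + (b d : ℚ) / (d + 1))) - ∑ d ∈ Finset.range n, ((a' d : ℚ) * (1 - 1 / (d + 1)) + (b' d : ℚ) / (d + 1)))), B, hBd, fun x hx => ?_, rfl⟩))
      (AddSubgroup.subset_closure (Or.inl ⟨P, N', hN'd, hN'i, rfl⟩))) ?_
    · rw [hBi hx]; simp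
    · rw [map_sub, eval_of, eval_of, ← hvB, hv, sub_self]
  have e : of N - of N' = (of N - of B) + (of B - of N') := by abel
  unfold Equivalent
  rw [e]
  exact relations.add_mem e1 e2

/-! ## Instances: `A = 1 + x + x²` and `A = 1 − x + x²` (new); `A = 1 + x²` is P3, `A = 1` is level two -/

/-- The polynomial edge data packaged for `affineBox_reduce`. [folklore] -/
theorem polyEdge_data (p : Polynomial ℚ) (hp : ∀ x ∈ Set.Icc (0:ℝ) 1, 0 < (Polynomial.aeval x p : ℝ)) :
    IsSemialgebraicFunOn ℚ {y : Fin 1 → ℝ | 0 < y 0 ∧ y 0 < 1}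
        (fun y => (fun x : ℝ => (Polynomial.aeval x p : ℝ)) (y 0)) ∧
      DifferentiableOn ℝ (fun y : Fin 1 → ℝ => (fun x : ℝ => (Polynomial.aeval x p : ℝ)) (y 0))
        {y : Fin 1 → ℝ | 0 < y 0 ∧ y 0 < 1} ∧
      (∀ x ∈ Set.Ioo (0:ℝ) 1, 0 < (fun x : ℝ => (Polynomial.aeval x p : ℝ)) x) ∧
      (∃ T : IntegralRep 2,
        T.domain = KZlog.band {y : Fin 1 → ℝ | 0 < y 0 ∧ y 0 < 1} (fun _ => (0:ℝ)) (fun _ => (1:ℝ)) ∧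
        T.integrand = fun z => 1 / ((fun x : ℝ => (Polynomial.aeval x p : ℝ)) (z 0) + z 0 * z 1)) := by
  obtain ⟨h1, -⟩ := affineUnfold_kit
  obtain ⟨hT, hsa, hdiff, -, -⟩ := h1 p hp
  exact ⟨hsa, hdiff, fun x hx => hp x ⟨hx.1.le, hx.2.le⟩, hT⟩

/-- **`[(0,1)², 3/(1 + x + x² + xy)] ~ [(0,1)², 1/(1 − xy)]`** (both of value `ζ(2)`): `A = 1 + x + x²`,
`(A+x)/A = G₂²/G₃`, `ρ = 2·½ − ⅔ = ⅓`. A new off-product transcendence-free instance of the leaf in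
dimension two, by rules (1a), (1b), (2) only. [cite: KontsevichZagier2001, §1.2 Conjecture 1] -/
theorem three_over_one_add_add_sq_add_mul_equivalent (N N' : IntegralRep 2)
    (hNd : N.domain = {x | ∀ i, x i ∈ Set.Ioo (0:ℝ) 1})
    (hNi : EqOn N.integrand (fun x => 3 / (1 + x 0 + x 0 ^ 2 + x 0 * x 1)) N.domain)
    (hN'd : N'.domain = {x | ∀ i, x i ∈ Set.Ioo (0:ℝ) 1})
    (hN'i : EqOn N'.integrand (fun x => 1 / (1 - x 0 * x 1)) N'.domain) :
    Equivalent N N' := by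
  have hp : ∀ x ∈ Set.Icc (0:ℝ) 1,
      0 < (Polynomial.aeval x (1 + Polynomial.X + Polynomial.X ^ 2 : Polynomial ℚ) : ℝ) := by
    intro x hx
    simp only [map_add, map_one, map_pow, Polynomial.aeval_X]
    nlinarith [hx.1, sq_nonneg x]
  obtain ⟨hsa, hdiff, hpos, hT⟩ := polyEdge_data _ hp
  obtain ⟨B, hBd, hBi⟩ := exists_zetaTwoRep 1
  have e1 := affineBox_reduce _ hsa hdiff hpos hT 3 (fun d => if d = 1 then 2 else 0) (fun _ => 0)
    (fun d => if d = 2 then 1 else 0) (fun _ => 0) (fun t ht => ?_) 3 N B hNd (fun x hx => ?_) hBd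
    (fun x hx => ?_)
  · have e2 : of B - of N' ∈ relations :=
      zetaTwoRep_congr_mem_relations B N' hBd hBi hN'd (fun x hx => by rw [hN'i hx]; simp)
    have e : of N - of N' = (of N - of B) + (of B - of N') := by abel
    unfold Equivalent
    rw [e]
    exact relations.add_mem e1 e2
  · -- the factorisation `(A+t)/A = (1+t)²/(1+t+t²)`
    have hA : (0:ℝ) < 1 + t + t ^ 2 := by nlinarith [ht.1, sq_nonneg t]
    simp only [map_add, map_one, map_pow, Polynomial.aeval_X, Finset.prod_range_succ,
      Finset.prod_range_zero, Finset.sum_range_succ, Finset.sum_range_zero]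
    norm_num
    field_simp
    ring
  · rw [hNi hx]
    simp only [map_add, map_one, map_pow, Polynomial.aeval_X]
    norm_num
  · rw [hBi hx]
    simp only [Finset.sum_range_succ, Finset.sum_range_zero]
    norm_num

/-- **`[(0,1)², 12/(1 − x + x² + xy)] ~ [(0,1)², 7/(1 − xy)]`** (both of value `7ζ(2)`): `A = 1 − x + x²`
(`= Φ₆`), `(A+x)/A = (1+x²)/(1−x+x²) = H₁H₆/(H₃H₄)` (`H_d = 1/(1−xᵈ)`), `ρ = 1 + ⅙ − ⅓ − ¼ = 7/12`.
[cite: KontsevichZagier2001, §1.2 Conjecture 1] -/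
theorem twelve_over_one_sub_add_sq_add_mul_equivalent (N N' : IntegralRep 2)
    (hNd : N.domain = {x | ∀ i, x i ∈ Set.Ioo (0:ℝ) 1})
    (hNi : EqOn N.integrand (fun x => 12 / (1 - x 0 + x 0 ^ 2 + x 0 * x 1)) N.domain)
    (hN'd : N'.domain = {x | ∀ i, x i ∈ Set.Ioo (0:ℝ) 1})
    (hN'i : EqOn N'.integrand (fun x => 7 / (1 - x 0 * x 1)) N'.domain) :
    Equivalent N N' := by
  have hp : ∀ x ∈ Set.Icc (0:ℝ) 1,
      0 < (Polynomial.aeval x (1 - Polynomial.X + Polynomial.X ^ 2 : Polynomial ℚ) : ℝ) := by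
    intro x hx
    simp only [map_add, map_sub, map_one, map_pow, Polynomial.aeval_X]
    nlinarith [sq_nonneg (x - 1/2)]
  obtain ⟨hsa, hdiff, hpos, hT⟩ := polyEdge_data _ hp
  obtain ⟨B, hBd, hBi⟩ := exists_zetaTwoRep 7
  have e1 := affineBox_reduce _ hsa hdiff hpos hT 6 (fun _ => 0)
    (fun d => if d = 0 ∨ d = 5 then 1 else 0) (fun _ => 0) (fun d => if d = 2 ∨ d = 3 then 1 else 0)
    (fun t ht => ?_) 12 N B hNd (fun x hx => ?_) hBd (fun x hx => ?_)
  · have e2 : of B - of N' ∈ relations :=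
      zetaTwoRep_congr_mem_relations B N' hBd hBi hN'd (fun x hx => by rw [hN'i hx]; simp)
    have e : of N - of N' = (of N - of B) + (of B - of N') := by abel
    unfold Equivalent
    rw [e]
    exact relations.add_mem e1 e2
  · -- the factorisation `(A+t)/A = (1+t²)/(1−t+t²) = H₁H₆/(H₃H₄)`
    have ht0 := ht.1
    have ht1 := ht.2
    have hA : (0:ℝ) < 1 - t + t ^ 2 := by nlinarith [sq_nonneg (t - 1/2)]
    have h1 : (0:ℝ) < 1 - t := by linarith
    have h3 : (0:ℝ) < 1 - t ^ 3 := sub_pos.2 (pow_lt_one₀ ht0.le ht1 (by norm_num))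
    have h4 : (0:ℝ) < 1 - t ^ 4 := sub_pos.2 (pow_lt_one₀ ht0.le ht1 (by norm_num))
    have h6 : (0:ℝ) < 1 - t ^ 6 := sub_pos.2 (pow_lt_one₀ ht0.le ht1 (by norm_num))
    simp only [map_add, map_sub, map_one, map_pow, Polynomial.aeval_X, Finset.prod_range_succ,
      Finset.prod_range_zero, Finset.sum_range_succ, Finset.sum_range_zero]
    norm_num
    field_simp
    ring
  · rw [hNi hx]
    simp only [map_add, map_sub, map_one, map_pow, Polynomial.aeval_X]
    norm_num
  · rw [hBi hx]
    simp only [Finset.sum_range_succ, Finset.sum_range_zero]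
    norm_num

end Summit.KontsevichZagierPeriods.HurwitzMicroSectors.NormalFormPrinciple.PiBox.M2
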